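import Summits.QuantumFields.YangMills.Theorems.BalabanUVNodesN07FrakGOfRecordGaugeCovariance
import HarnessLib

/-!
# NODE N07 — [15] (45)∕(103) AT THE RECORD: def-Y's `H₁(U₀) = H1OfRecordAtBgFlat` IS GAUGE COVARIANT AND ITS (103)-NORM IS GAUGE INVARIANT

Cell `pub-ymgap`, width seat `pub-ymgap-dag-n07-w3` (g24), CLAIM-7.  `--kind proof --supports stmt-QuantumFields-27238 --as helper`; count-neutral.
[B9] = [Balaban1985BackgroundPropagators]; [15] = [Balaban1985Variational].

WHY.  The `𝔄 = H₁B` slot of the background scheme (M2-PLAN §2, token T-H = [15] (103)∕(46): `|H₁B| ≤ B₀·|B|·(Lʲη)⁻¹`, i.e. an operator-norm bound on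
`H₁ = G₁Q*(QG₁Q*)⁻¹` from block fields `|·|_{(−0)}` to the space (115)) has, like (117) for `𝔊` (✓p817387), a GAUGE-INVARIANT left-hand side: with [B9] (3.32)
`Q(U^u)R(u) = R_k(u)Q(U)`, (3.34b) `G₁(U^u)R(u) = R(u)G₁(U)` and the intertwined `(QG₁Q*)⁻¹` (✓p817387 `KinvLatticeK_gaugeAct`), `H₁(U^u) R_k(u) = R(u) H₁(U)`, and `R_k(u)`,
`R(u)` are isometries of the block carrier and of (115).  So T-H, too, may be proved in any gauge, and holds on the flat orbit iff at `U₀ = 1`.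

WHAT IS PROVED (sorry-free; no definition; axioms standard).
* §1 ★★ `H1OfRecordAtBgFlat_equiv` (bookkeeping: the configuration underlying `H₁B` IS `phiRec` of `G₁Q†(QG₁Q*)⁻¹` of the Hilbert letters applied to `B` read into `WL2`),
  ★★ `H1OfRecordAtBgFlat_gaugeAct` (`H₁(u • U₀)(Ad_{ū} B) = Ad_u (H₁(U₀) B)` on the underlying functions, `ū = u_k(c₋)`), on 35b's guard (`k ≤ m + K`).
* §2 `norm_negSize_blocks_AdA` (the block carrier `|·|_{(−0)}` over `PBond (F.P K) k` is `Ad`-isometric), ★★★ `norm_H1OfRecordAtBgFlat_gaugeAct :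
  ‖H1OfRecordAtBgFlat F N K k Ω (u • U₀) levB a hpos′ hQ′‖ = ‖H1OfRecordAtBgFlat F N K k Ω U₀ levB a hpos hQ‖`, ★★★ `norm_H1OfRecordAtBgFlat_pureGauge` (`u • 1` vs `1`).

HONEST SCOPE.  Covariance∕invariance identities only: (103)∕(46) `‖H₁‖ ≤ …` is NOT proved at any background; `hpos`, `hQ` stay DISPLAYED; the `L²`-operator matrix norm of 3a is
the one used; nothing of [B9]∕[15] asserted; P0 OPEN; N07 NOT discharged; K0ᴬ∕K1ᴬ∕K3ᴬ OPEN; counts unmoved (28∕28 · 8∕28 · K 1∕4); one finite 𝕋⁴ programme at fixed ε — R4 closes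
the conditional finite-𝕋⁴ rung `BalabanLadder.UV` only, never the summit; nothing continuum ∕ ℝ⁴ ∕ OS; the Yang–Mills mass gap (Clay) is NOT proved by any of this.
No `sorry`, no `def`, no `instance`, no `notation`.

References: [15] (45) p.285, (103) p.293, (115) p.294; [B9] (3.32)–(3.34) p.396, p.398.
-/

set_option autoImplicit false

noncomputable section

open scoped Matrix.Norms.L2Operator InnerProductSpace ComplexConjugate

namespace Summit.QuantumFields.YangMills.Theorems.N07H1OfRecordGaugeCovariance

open Literature.MathematicalPhysics.QuantumFieldTheory.Balaban1983to89
open Literature.MathematicalPhysics.QuantumFieldTheory.Balaban1983to89.T4Continuum (T4Family)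
open T4Continuum BlockAveraging
open B4Sect5Torus (TSite)
open B9SectCLatticeCarrier (Bond bpos btgt)
open B9Eq311L2Pairing (WL2)
open B11Eq115Space (NegSup JetSup NegSize)
open B11Eq111FrakG (nabla115)
open B11Eq103H1Complex (BondL2K funEquiv funEquiv_apply G1LatticeK KinvLatticeK H1LatticeK H1LatticeK_eq H1LatticeCLM H1CLM_apply)
open B9Eq328GaugeAction (gaugeW AdA AdA_apply_inv)
open B16Sect1Backgrounds (toMS)
open Node00
open Summit.QuantumFields.YangMills.Theorems.N07LaplaceAOfRecordGaugeOrbitPos (adjoint_QOfRecord_gaugeAct smallBelow_one)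
open Summit.QuantumFields.YangMills.Theorems.N07FrakGOfRecordGaugeCovariance (norm_AdA_suToUnits funEquiv_gaugeW G1LatticeK_gaugeAct KinvLatticeK_gaugeAct
  norm_space115Lit_AdA)
open GaugeField (gaugeAct)

variable (F : T4Family) (N : ℕ) [NeZero N] {K : ℕ} (k : ℕ) (u : GaugeTransf (F.P K) 0 (SU N)) (U₀ : GaugeField (F.P K) 0 (SU N))

/-! ## §1  `H₁ = G₁Q†(QG₁Q*)⁻¹` read on the functions, and its gauge covariance -/

omit [NeZero N] in
/-- ★★ **BOOKKEEPING: `H₁(U₀)B` IS `G₁Q†(QG₁Q*)⁻¹` OF LIT'S HILBERT LETTERS** — the configuration underlying `H1OfRecordAtBgFlat … U₀ levB a hpos hQ B` is `phiRec` of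
`G₁(Q†((QG₁Q*)⁻¹ y))` for the block field `y` reading `B`. [cite: Balaban1985Variational, (45) p.285, (103) p.293] -/
theorem H1OfRecordAtBgFlat_equiv [Fact (0 < (F.L : ℝ))] [Fact (0 < (F.P K).eta k)] [Fact (0 < c0Rec F K k)] [Fact (∀ c, 0 < wBRec F K k c)]
    (Ω : ℕ → Set (Site (F.P K) 0)) (levB : PBond (F.P K) k → ℕ) {a : ℝ}
    (hpos : ∀ x, x ≠ 0 → 0 < RCLike.re ⟪x, laplaceAOfRecord F N k U₀ (QOfRecord F N k U₀) (QflatOfRecord F N k) a x⟫_ℂ)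
    (hQ : Function.Surjective (QOfRecord F N k U₀)) (B : NegSize (F.L : ℝ) ((F.P K).eta k) levB 0 (Matrix (Fin N) (Fin N) ℂ))
    (y : WL2 ℂ (wBRec F K k) (WRec N)) (hBy : NegSup.equiv _ _ B = funEquiv (phiRec N) (wBRec F K k) y) :
    JetSup.equiv _ _ _ (H1OfRecordAtBgFlat F N K k Ω U₀ levB a hpos hQ B) =
      funEquiv (phiRec N) (fun _ => c0Rec F K k) (G1LatticeK hpos (LinearMap.adjoint (QOfRecord F N k U₀) (KinvLatticeK hpos hQ y))) := by
  have hy : (funEquiv (phiRec N) (wBRec F K k)).symm (NegSup.equiv _ _ B) = y := by rw [hBy, LinearEquiv.symm_apply_apply]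
  funext x
  rw [H1OfRecordAtBgFlat_eq]
  unfold H1OfRecord H1LatticeCLM
  rw [H1CLM_apply, hy, H1LatticeK_eq, funEquiv_apply]
  rfl

/-- ★★ **`H₁` IS GAUGE COVARIANT: `H₁(u • U₀)(Ad_{ū} B) = Ad_u (H₁(U₀) B)`** on the underlying functions (`Ad_{ū}` = `c ↦ Ad_{u_k(c₋)}` on the block fields, [16] (1.15);
`Ad_u` = `b ↦ Ad_{u(b₋)}`), for def-Y's `H1OfRecordAtBgFlat` on 35b's guard — (3.32), (3.34b) and the intertwined `(QG₁Q*)⁻¹`.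
[cite: Balaban1985Variational, (45) p.285, (103) p.293; Balaban1985BackgroundPropagators, (3.32)–(3.34) p.396] -/
theorem H1OfRecordAtBgFlat_gaugeAct [Fact (0 < (F.L : ℝ))] [Fact (0 < (F.P K).eta k)] [Fact (0 < c0Rec F K k)] [Fact (∀ c, 0 < wBRec F K k c)]
    (Ω : ℕ → Set (Site (F.P K) 0)) (levB : PBond (F.P K) k → ℕ) (hk : k ≤ (F.P K).m + (F.P K).K) (h : SmallBelow (avOfRecord F N K) k U₀) {a : ℝ}
    (hpos : ∀ x, x ≠ 0 → 0 < RCLike.re ⟪x, laplaceAOfRecord F N k U₀ (QOfRecord F N k U₀) (QflatOfRecord F N k) a x⟫_ℂ)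
    (hQ : Function.Surjective (QOfRecord F N k U₀))
    (hpos' : ∀ x, x ≠ 0 → 0 < RCLike.re ⟪x, laplaceAOfRecord F N k (gaugeAct u U₀) (QOfRecord F N k (gaugeAct u U₀)) (QflatOfRecord F N k) a x⟫_ℂ)
    (hQ' : Function.Surjective (QOfRecord F N k (gaugeAct u U₀))) (B B' : NegSize (F.L : ℝ) ((F.P K).eta k) levB 0 (Matrix (Fin N) (Fin N) ℂ))
    (hBB' : NegSup.equiv _ _ B' = fun c : PBond (F.P K) k => AdA (suToUnits N (toMS u k c.src)) (NegSup.equiv _ _ B c)) :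
    JetSup.equiv _ _ _ (H1OfRecordAtBgFlat F N K k Ω (gaugeAct u U₀) levB a hpos' hQ' B') =
      fun b => AdA (suToUnits N (u ((siteToLit (F.P K) 0).symm (bpos b)))) (JetSup.equiv _ _ _ (H1OfRecordAtBgFlat F N K k Ω U₀ levB a hpos hQ B) b) := by
  set y := (funEquiv (phiRec N) (wBRec F K k)).symm (NegSup.equiv _ _ B) with hy
  have hBy : NegSup.equiv _ _ B = funEquiv (phiRec N) (wBRec F K k) y := by rw [hy, LinearEquiv.apply_symm_apply]
  have hB'y : NegSup.equiv _ _ B' = funEquiv (phiRec N) (wBRec F K k) (gaugeW (phiRec N) (fun c : PBond (F.P K) k => suToUnits N (toMS u k c.src)) y) := by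
    rw [hBB', funEquiv_gaugeW, ← hBy]
  rw [H1OfRecordAtBgFlat_equiv F N k (gaugeAct u U₀) Ω levB hpos' hQ' B' _ hB'y, H1OfRecordAtBgFlat_equiv F N k U₀ Ω levB hpos hQ B y hBy,
    KinvLatticeK_gaugeAct F N k u U₀ hk h hpos hQ hpos' hQ', adjoint_QOfRecord_gaugeAct F N k u U₀ hk h, G1LatticeK_gaugeAct F N k u U₀ hk h hpos hpos',
    funEquiv_gaugeW]

/-! ## §2  The block carrier is `Ad`-isometric; T-H's norm `‖H₁(U₀)‖` is constant along gauge orbits (on the guard); every pure gauge -/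

omit [NeZero N] in
/-- **THE BLOCK CARRIER `|·|_{(−0)}` OVER THE `k`-BONDS IS `Ad`-INVARIANT**: two block fields whose underlying functions differ by `c ↦ Ad_{s(c)}`, `s(c) ∈ SU(N)`, have the same norm.
[cite: Balaban1985Variational, p.286, (103) p.293; Balaban1985BackgroundPropagators, p.398] -/
theorem norm_negSize_blocks_AdA [Fact (0 < (F.L : ℝ))] [Fact (0 < (F.P K).eta k)] {levB : PBond (F.P K) k → ℕ} {n : ℕ} (s : PBond (F.P K) k → SU N)
    (B B' : NegSize (F.L : ℝ) ((F.P K).eta k) levB n (Matrix (Fin N) (Fin N) ℂ))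
    (hBB' : NegSup.equiv _ _ B' = fun c => AdA (suToUnits N (s c)) (NegSup.equiv _ _ B c)) : ‖B'‖ = ‖B‖ := by
  have hp : NegSup.profile _ B' = NegSup.profile _ B := by
    funext c
    simp only [NegSup.profile_apply, hBB', norm_AdA_suToUnits]
  rw [NegSup.norm_def B', NegSup.norm_def B, hp]

/-- ★★★ **GAUGE INVARIANCE OF THE (103)-NORM OF def-Y's `H₁`**: `‖H₁(u • U₀)‖ = ‖H₁(U₀)‖` as operators `|·|_{(−0)} → (115)`, whatever displayed proofs `hpos`, `hQ` are supplied —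
the T-H bound of the scheme may be proved in any gauge. [cite: Balaban1985Variational, (103) p.293, (46) p.285; Balaban1985BackgroundPropagators, (3.34) p.396, p.398] -/
theorem norm_H1OfRecordAtBgFlat_gaugeAct [Fact (0 < (F.L : ℝ))] [Fact (0 < (F.P K).eta k)] [Fact (0 < c0Rec F K k)] [Fact (∀ c, 0 < wBRec F K k c)]
    (Ω : ℕ → Set (Site (F.P K) 0)) (levB : PBond (F.P K) k → ℕ) (hk : k ≤ (F.P K).m + (F.P K).K) (h : SmallBelow (avOfRecord F N K) k U₀) {a : ℝ}
    (hpos : ∀ x, x ≠ 0 → 0 < RCLike.re ⟪x, laplaceAOfRecord F N k U₀ (QOfRecord F N k U₀) (QflatOfRecord F N k) a x⟫_ℂ)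
    (hQ : Function.Surjective (QOfRecord F N k U₀))
    (hpos' : ∀ x, x ≠ 0 → 0 < RCLike.re ⟪x, laplaceAOfRecord F N k (gaugeAct u U₀) (QOfRecord F N k (gaugeAct u U₀)) (QflatOfRecord F N k) a x⟫_ℂ)
    (hQ' : Function.Surjective (QOfRecord F N k (gaugeAct u U₀))) :
    ‖H1OfRecordAtBgFlat F N K k Ω (gaugeAct u U₀) levB a hpos' hQ'‖ = ‖H1OfRecordAtBgFlat F N K k Ω U₀ levB a hpos hQ‖ := by
  apply le_antisymm
  · refine ContinuousLinearMap.opNorm_le_bound _ (norm_nonneg (H1OfRecordAtBgFlat F N K k Ω U₀ levB a hpos hQ)) fun B' => ?_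
    set B : NegSize (F.L : ℝ) ((F.P K).eta k) levB 0 (Matrix (Fin N) (Fin N) ℂ) :=
      (NegSup.equiv _ _).symm (fun c : PBond (F.P K) k => AdA (suToUnits N (toMS u k c.src))⁻¹ (NegSup.equiv _ _ B' c)) with hB
    have hBB' : NegSup.equiv _ _ B' = fun c : PBond (F.P K) k => AdA (suToUnits N (toMS u k c.src)) (NegSup.equiv _ _ B c) := by
      funext c
      simp only [hB, Equiv.apply_symm_apply, AdA_apply_inv]
    rw [norm_space115Lit_AdA F N k u U₀ Ω _ _ (H1OfRecordAtBgFlat_gaugeAct F N k u U₀ Ω levB hk h hpos hQ hpos' hQ' B B' hBB'),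
      norm_negSize_blocks_AdA F N k _ B B' hBB']
    exact ContinuousLinearMap.le_opNorm _ B
  · refine ContinuousLinearMap.opNorm_le_bound _ (norm_nonneg (H1OfRecordAtBgFlat F N K k Ω (gaugeAct u U₀) levB a hpos' hQ')) fun B => ?_
    set B' : NegSize (F.L : ℝ) ((F.P K).eta k) levB 0 (Matrix (Fin N) (Fin N) ℂ) :=
      (NegSup.equiv _ _).symm (fun c : PBond (F.P K) k => AdA (suToUnits N (toMS u k c.src)) (NegSup.equiv _ _ B c)) with hB'
    have hBB' : NegSup.equiv _ _ B' = fun c : PBond (F.P K) k => AdA (suToUnits N (toMS u k c.src)) (NegSup.equiv _ _ B c) := by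
      rw [hB', Equiv.apply_symm_apply]
    rw [← norm_space115Lit_AdA F N k u U₀ Ω _ _ (H1OfRecordAtBgFlat_gaugeAct F N k u U₀ Ω levB hk h hpos hQ hpos' hQ' B B' hBB'),
      ← norm_negSize_blocks_AdA F N k _ B B' hBB']
    exact ContinuousLinearMap.le_opNorm _ B'

omit U₀ in
/-- ★★★ **EVERY PURE GAUGE HAS THE FLAT BACKGROUND'S (103)-NORM**: `‖H₁(u • 1)‖ = ‖H₁(1)‖` for def-Y's `H1OfRecordAtBgFlat` (flat background on the guard at every level). So T-H on the whole
gauge orbit of `1` ⟸ T-H at `U₀ = 1`. [cite: Balaban1985Variational, (103) p.293; Balaban1985BackgroundPropagators, p.398] -/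
theorem norm_H1OfRecordAtBgFlat_pureGauge [Fact (0 < (F.L : ℝ))] [Fact (0 < (F.P K).eta k)] [Fact (0 < c0Rec F K k)] [Fact (∀ c, 0 < wBRec F K k c)]
    (Ω : ℕ → Set (Site (F.P K) 0)) (levB : PBond (F.P K) k → ℕ) (hk : k ≤ (F.P K).m + (F.P K).K) {a : ℝ}
    (hpos₁ : ∀ x, x ≠ 0 → 0 < RCLike.re ⟪x, laplaceAOfRecord F N k 1 (QOfRecord F N k 1) (QflatOfRecord F N k) a x⟫_ℂ)
    (hQ₁ : Function.Surjective (QOfRecord F N k (1 : GaugeField (F.P K) 0 (SU N))))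
    (hpos' : ∀ x, x ≠ 0 → 0 < RCLike.re ⟪x, laplaceAOfRecord F N k (gaugeAct u 1) (QOfRecord F N k (gaugeAct u 1)) (QflatOfRecord F N k) a x⟫_ℂ)
    (hQ' : Function.Surjective (QOfRecord F N k (gaugeAct u 1))) :
    ‖H1OfRecordAtBgFlat F N K k Ω (gaugeAct u 1) levB a hpos' hQ'‖ = ‖H1OfRecordAtBgFlat F N K k Ω 1 levB a hpos₁ hQ₁‖ :=
  norm_H1OfRecordAtBgFlat_gaugeAct F N k u 1 Ω levB hk (smallBelow_one N k) hpos₁ hQ₁ hpos' hQ'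

end Summit.QuantumFields.YangMills.Theorems.N07H1OfRecordGaugeCovariance

end
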